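import Summits.HodgeConjecture.HodgeConjecture.Theorems.Ring2WeilCoverageNormClassEq
import Summits.HodgeConjecture.HodgeConjecture.Theorems.Ring2WeilCoverageNormTableC
import HarnessLib

/-!
# Weil-type family coverage — product windows, part Q: the MAXIMAL-DIMENSIONAL trigonal-Prym families on R1, R2, W6.3.11; the row `n = 253` over `ℚ(i)`;
# and the FIRST curve-carried members on `W6.2.23 = (3, ℚ(√-2), [23])` (`GL₂(3) × S₂₃ / A₂₃`)

research route conditional on HC_CM; not a corollary; Q11.4-sentence-2 already refuted in dim ≥ 3.

Ring 2, WEIL-TYPE FAMILY-COVERAGE CENSUS (`HOME/WEIL-FAMILY-COVERAGE.md` `## b04`, block b04.15 P.S. 3, owner ring2-b04, gen 51); seventeenth part of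
`Ring2WeilCoverageProductWindow` (same conventions as parts L–P; engine `symwin.py` + `bigwin.py`; mirror `HOME/pub-hodge-ring2-b04/census-g51/`).
THEOREM S9's trigonal Pryms `P(Y_φ/E_ω)`, `Y_φ : y³ = φ(φ−1)`, come in families of dimension `7 + Σt₃ − n ≤ 3` (number of free critical values of
`φ`; `Σt₃` = number of 3-divisible cycles at the three fixed branch values); the maximum 3 is attained exactly when the nine odd points are six
simple points and three double points and every other ramification index over `{0,1,∞}` is 3.  LITERAL CLASSES for the smallest-degree such
families on pub-hsemireg's TARGET rows: **R1 = W6.3.2 at `deg φ = 6`** (`C₃ × S₆` datum `(3², 2.1⁴, 2².1²)` + three free simple branch values =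
a THREE-parameter family of genus-7 curves `y³ = D(C³ − D)`, `D = (t−p)²(t−q)²(t−r)(t−s)`, `C` quadratic with `C³ − D` having a double root;
Galois closure of genus 1 981; `det H = -32/3`, `T = {2,3}`) and **R2 = W6.3.5 at `deg φ = 5`** (`(2.1³, 2.1³, 3.2)` + three free values: `φ =
P₅/((t−a)³(t−b)²)` with `P₅` and `P₅ − (t−a)³(t−b)²` each having a double root; Galois genus 361; `det H = -64/5`, `T = {3,5}`); and the uniform
pillowcase polygon of THEOREM S10 over `ℚ(i)` at `n = 253 = 11·23` (kit j205487; 1 012 sheets, 70 min): `(3,3)`, `det H = -2/253`, `T = {11,23}` =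
`W6.1.253`, with the row key `253 ∉ Nm(ℚ(i)ˣ)` (inert prime 11) proved in §0; the three-parameter `deg 11` family `(3².2.1³, 3².2.1³, 3³.2)` on
`W6.3.11` (`det H = -256/11`); and §2: **the FIRST curve-carried members on `W6.2.23 = (3, ℚ(√-2), [23])`** — two rigid data of the window
`GL₂(3) × S₂₃ / A₂₃` (`GL₂(3)` ring2-b02's degree-2 carrier of `ℚ(√-2)`, `H₁` a reflection; generic carrier scan `symwin.py gscan`, random
realisation, 552 sheets, kit j206799 / j206800): `(3:3⁷.2, 2:2¹¹.1, 8a:8.4³.3)` (`S₂₃`; `det H = -1/5589 = -1/(3⁵·23)`) and `(3:3⁷.1², 2:4.2⁹.1,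
8a:8².4.2.1)` (`A₂₃`; `-2/1863 = -2/(3⁴·23)`), both `(3,3)`, `T = {2,23}`, class `[23]` = THEOREM S7's `[n]^{r₁}` with `r₁ = 1` (`S_in(GL₂(3)) = ∅`).
Data of the same literal class already certified (the 1- and 2-parameter `deg 6` families on R1: `-32/3` once; the 2- and 3-parameter `deg 5`
families on R2, `-64/5`: the cell identification is part B's `pwC3A5_c13_c13_c15A_q0_g25_mk_detH_eq_key`) are recorded in the census only.

No `def`, no named fact, no `sorry`; nothing here is a statement about Hodge classes; `HC_CM` is used nowhere.
References: [cite: vanGeemen1994HodgeAV, (5.4.1), Lemma 5.2]; [cite: Serre1973, Ch. III §1].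
-/

set_option linter.dupNamespace false

open Literature.AlgebraicGeometry.Motives
open Literature.AlgebraicGeometry.VanGeemen1994
open Summit.HodgeConjecture.HodgeConjecture.Ring2.Hypotheses

namespace Summit.HodgeConjecture.HodgeConjecture.Ring2.WeilCoverage

namespace SqrtNeg1

/-- `253 ∉ Nm(ℚ(√-1)ˣ)`: descent at the inert prime `11` (`-1` is a non-square mod `11`, `11 ∥ 253 = 11·23`); `T(253) = {11, 23}` — the row key of
`W6.1.253`. research route conditional on HC_CM; not a corollary; Q11.4-sentence-2 already refuted in dim ≥ 3. [cite: Serre1973, Ch. III §1] -/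
theorem not_mem_253 : Units.mk0 (253 : ℚ) (by norm_num) ∉ normUnitsSubgroup ℚ (weilField 1) := by
  simpa using natCast_not_mem_normUnitsSubgroup_of_inert (d := 1) (a := 253) (p := 11)
    (by norm_num) (by decide) (by norm_num) (by norm_num) (by norm_num)

end SqrtNeg1

/-! ### §1 Three-parameter families on R1 (`deg 6`), R2 (`deg 5`), W6.3.11 (`deg 11`); `W6.1.253` -/

/-- FIBRE-PRODUCT datum `C3xS5` `(0; c1:2.1^3,c1:2.1^3,c1:3.2,c0:2.1^3,c0:2.1^3,c0:2.1^3)` (cycle types in `S5`; Hurwitz dimension 3; realised by explicit permutations with product one, generation: 2-transitive + Jordan (a 2-cycle as the 1-th power of a branch cycle, 2 <= n-3) => monodromy >= A_5): `Y = D ×_{ℙ¹} X` (genus 7; `D` the `C3`-quotient datum = the CM elliptic curve, `X` the degree-5 cover, genus 0), computed on its 15 sheets (engine `bigwin.py`, exact); the HIDDEN FACTOR `B` = the `λ`-part of the Prym `P(Y/D)` — an abelian SIXFOLD with `(3,3)` `ℚ(√-3)`-action, WEIL TYPE — has literal `det H|_B = -64/5`, `a = 64/5`, `T(a) = [3, 5]`: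 row `W6.3.5` (NON-split); `r₁ = dim_K H¹(D)_λ = 1`, `r_H = 7`. THEOREM S8 (Prym form of the product-window law, census b04.15 (A): `[a_B] = [n]^{r₁}`, no 2-transitivity needed) predicts `T(a_B) = [3, 5]` from `r₁ = 1`, `n = 5` — CONFIRMED.
research route conditional on HC_CM; not a corollary; Q11.4-sentence-2 already refuted in dim ≥ 3. [cite: vanGeemen1994HodgeAV, (5.4.1)] -/
theorem fibre_C3S5_n5_f16e50_mk_detH_ne_split :
    (QuotientGroup.mk (Units.mk0 (((-64 : ℚ) / 5)) (by norm_num)) : weilNormResidueGroup 3) ≠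
      splitDiscriminantClass 3 3 := by
  have e : Units.mk0 (((-64 : ℚ) / 5)) (by norm_num) = -(Units.mk0 ((64 : ℚ) / 5) (by norm_num)) := Units.ext (by norm_num)
  rw [Ne, e, mk_neg_eq_splitDiscriminantClass_iff_of_odd (n := 3) (by decide)]
  have h := mul_not_mem_normUnitsSubgroup (mem_normUnitsSubgroup_of_sq_add_mul_sq (d := 3) (a := ((64 : ℚ) / 25)) (by norm_num) ((8 : ℚ) / 5) (0 : ℚ) (by norm_num))
    Summit.HodgeConjecture.Ring2WeilNormDescent.five_not_mem_norm_three
  rw [mk0_mul_mk0] at h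
  norm_num at h
  exact h

-- CELL IDENTIFICATION of this datum (`[det H|_B] = [-64/5] = [-5]`, the ROW KEY of `W6.3.5` = R2): the literal statement is ALREADY in the tree as
-- `Summit.HodgeConjecture.HodgeConjecture.Ring2.WeilCoverage.pwC3A5_c13_c13_c15A_q0_g25_mk_detH_eq_key` (part B; the `C₃ × A₅` surface datum g 25 has the same literal `det H`) — reused by name, not restated.

/-- FIBRE-PRODUCT datum `C3xS6` `(0; c1:3^2,c1:2.1^4,c1:2^2.1^2,c0:2.1^4,c0:2.1^4,c0:2.1^4)` (cycle types in `S6`; Hurwitz dimension 3; realised by explicit permutations with product one, generation: 2-transitive + Jordan (a 2-cycle as the 1-th power of a branch cycle, 2 <= n-3) => monodromy >= A_6): `Y = D ×_{ℙ¹} X` (genus 7; `D` the `C3`-quotient datum = the CM elliptic curve, `X` the degree-6 cover, genus 0), computed on its 18 sheets (engine `bigwin.py`, exact); the HIDDEN FACTOR `B` = the `λ`-part of the Prym `P(Y/D)` — an abelian SIXFOLD with `(3,3)` `ℚ(√-3)`-action, WEIL TYPE — has literal `det H|_B = -32/3`, `a = 32/3`, `T(a) = [2, 3]`: row `W6.3.2`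 (NON-split); `r₁ = dim_K H¹(D)_λ = 1`, `r_H = 7`. THEOREM S8 (Prym form of the product-window law, census b04.15 (A): `[a_B] = [n]^{r₁}`, no 2-transitivity needed) predicts `T(a_B) = [2, 3]` from `r₁ = 1`, `n = 6` — CONFIRMED.
research route conditional on HC_CM; not a corollary; Q11.4-sentence-2 already refuted in dim ≥ 3. [cite: vanGeemen1994HodgeAV, (5.4.1)] -/
theorem fibre_C3S6_n6_68bbbe_mk_detH_ne_split :
    (QuotientGroup.mk (Units.mk0 (((-32 : ℚ) / 3)) (by norm_num)) : weilNormResidueGroup 3) ≠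
      splitDiscriminantClass 3 3 := by
  have e : Units.mk0 (((-32 : ℚ) / 3)) (by norm_num) = -(Units.mk0 ((32 : ℚ) / 3) (by norm_num)) := Units.ext (by norm_num)
  rw [Ne, e, mk_neg_eq_splitDiscriminantClass_iff_of_odd (n := 3) (by decide)]
  have h := mul_not_mem_normUnitsSubgroup (mem_normUnitsSubgroup_of_sq_add_mul_sq (d := 3) (a := ((16 : ℚ) / 3)) (by norm_num) (0 : ℚ) ((4 : ℚ) / 3) (by norm_num))
    Summit.HodgeConjecture.Ring2WeilNormDescent.two_not_mem_norm_three
  rw [mk0_mul_mk0] at h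
  norm_num at h
  exact h

/-- The same datum, CELL IDENTIFICATION: `[det H|_B] = [-2]` in `ℚˣ/Nm(ℚ(√-3)ˣ)` — the census ROW KEY of `W6.3.2` (`a·2 = ((64 : ℚ) / 3) = ((0 : ℚ))² + 3·(((8 : ℚ) / 3))²`).
research route conditional on HC_CM; not a corollary; Q11.4-sentence-2 already refuted in dim ≥ 3. [cite: vanGeemen1994HodgeAV, Lemma 5.2 (3)] -/
theorem fibre_C3S6_n6_68bbbe_mk_detH_eq_key :
    (QuotientGroup.mk (Units.mk0 (-(((32 : ℚ) / 3))) (neg_ne_zero.2 (by norm_num))) : weilNormResidueGroup 3) =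
      QuotientGroup.mk (Units.mk0 (-(2 : ℚ)) (neg_ne_zero.2 (by norm_num))) :=
  mk_neg_eq_mk_neg_of_mul_mem (by norm_num) (by norm_num)
    (mem_normUnitsSubgroup_of_sq_add_mul_sq _ (0 : ℚ) ((8 : ℚ) / 3) (by norm_num))

/-- FIBRE-PRODUCT datum `C3xS11` `(0; c1:3^2.2.1^3,c1:3^2.2.1^3,c1:3^3.2,c0:2.1^9,c0:2.1^9,c0:2.1^9)` (cycle types in `S11`; Hurwitz dimension 3; realised by explicit permutations with product one, generation: 2-transitive + Jordan (a 2-cycle as the 3-th power of a branch cycle, 2 <= n-3) => monodromy >= A_11): `Y = D ×_{ℙ¹} X` (genus 7; `D` the `C3`-quotient datum = the CM elliptic curve, `X` the degree-11 cover, genus 0), computed on its 33 sheets (engine `bigwin.py`, exact); the HIDDEN FACTOR `B` = the `λ`-part of the Prym `P(Y/D)` — an abelian SIXFOLD with `(3,3)` `ℚ(√-3)`-action, WEIL TYPE — has literal `det H|_B = -256/11`, `a = 256/11`, `T(a) = [3, 11]`: row `W6.3.11` (NON-split); `r₁ = dim_K H¹(D)_λ = 1`, `r_H = 7`. THEOREM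 S8 (Prym form of the product-window law, census b04.15 (A): `[a_B] = [n]^{r₁}`, no 2-transitivity needed) predicts `T(a_B) = [3, 11]` from `r₁ = 1`, `n = 11` — CONFIRMED.
research route conditional on HC_CM; not a corollary; Q11.4-sentence-2 already refuted in dim ≥ 3. [cite: vanGeemen1994HodgeAV, (5.4.1)] -/
theorem fibre_C3S11_n11_a04bbe_mk_detH_ne_split :
    (QuotientGroup.mk (Units.mk0 (((-256 : ℚ) / 11)) (by norm_num)) : weilNormResidueGroup 3) ≠
      splitDiscriminantClass 3 3 := by
  have e : Units.mk0 (((-256 : ℚ) / 11)) (by norm_num) = -(Units.mk0 ((256 : ℚ) / 11) (by norm_num)) := Units.ext (by norm_num)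
  rw [Ne, e, mk_neg_eq_splitDiscriminantClass_iff_of_odd (n := 3) (by decide)]
  have h := mul_not_mem_normUnitsSubgroup (mem_normUnitsSubgroup_of_sq_add_mul_sq (d := 3) (a := ((256 : ℚ) / 121)) (by norm_num) ((16 : ℚ) / 11) (0 : ℚ) (by norm_num))
    Summit.HodgeConjecture.Ring2WeilNormDescent.eleven_not_mem_norm_three
  rw [mk0_mul_mk0] at h
  norm_num at h
  exact h

/-- The same datum, CELL IDENTIFICATION: `[det H|_B] = [-11]` in `ℚˣ/Nm(ℚ(√-3)ˣ)` — the census ROW KEY of `W6.3.11` (`a·11 = (256 : ℚ) = ((16 : ℚ))² + 3·((0 : ℚ))²`).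
research route conditional on HC_CM; not a corollary; Q11.4-sentence-2 already refuted in dim ≥ 3. [cite: vanGeemen1994HodgeAV, Lemma 5.2 (3)] -/
theorem fibre_C3S11_n11_a04bbe_mk_detH_eq_key :
    (QuotientGroup.mk (Units.mk0 (-(((256 : ℚ) / 11))) (neg_ne_zero.2 (by norm_num))) : weilNormResidueGroup 3) =
      QuotientGroup.mk (Units.mk0 (-(11 : ℚ)) (neg_ne_zero.2 (by norm_num))) :=
  mk_neg_eq_mk_neg_of_mul_mem (by norm_num) (by norm_num)
    (mem_normUnitsSubgroup_of_sq_add_mul_sq _ (16 : ℚ) (0 : ℚ) (by norm_num))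

/-- PILLOWCASE datum (B₂ alcove lattice, orbifold `ℙ¹(4,4,2) = E_i/C₄`): the double of the lattice 9-gon `P` with turning sequence `-2,+1,+3,-2,+2,+2,-1,+2,+3` (×45°) and side lengths `1,1,1,1,124,1,124,1,1` is a Belyi map `φ_P : ℙ¹ → ℙ¹` of degree `n = 253` (= number of alcoves of `P`) with passport `(5.4^61.2.1^2, 4^62.3.2, 3^2.2^123.1)` and monodromy group `S253` (certified: randomized Schreier–Sims lower bound = the full order); `Y_P : y⁴ = φ_P(φ_P − 1)` (genus 8) is the normalised fibre product `E ×_{ℙ¹} ℙ¹_{φ_P}` (1012 sheets over `ℙ¹`; engine `bigwin.py`, exact) and the HIDDEN FACTOR `B` = the `λ`-part of the Prym `P(Y_P/E)` — an abelian SIXFOLD with `(3,3)` `ℚ(√-1)`-action, WEIL TYPE — has literal `det H|_B = -2/253`, `a = 2/253`, `T(a) = [11, 23]`: row `W6.1.253` (NON-split); `r₁ = dim_K H¹(D)_λ = 1`, `r_H = 7`. THEOREM S8 (Prym form of the product-window law, census b04.15 (A): `[a_B] = [n]^{r₁}`, no 2-transitivity needed) predicts `T(a_B) = [11, 23]` from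 `r₁ = 1`, `n = 253` — CONFIRMED.
research route conditional on HC_CM; not a corollary; Q11.4-sentence-2 already refuted in dim ≥ 3. [cite: vanGeemen1994HodgeAV, (5.4.1)] -/
theorem pillow4_C4S253_n253_e00d92_mk_detH_ne_split :
    (QuotientGroup.mk (Units.mk0 (((-2 : ℚ) / 253)) (by norm_num)) : weilNormResidueGroup 1) ≠
      splitDiscriminantClass 3 1 := by
  have e : Units.mk0 (((-2 : ℚ) / 253)) (by norm_num) = -(Units.mk0 ((2 : ℚ) / 253) (by norm_num)) := Units.ext (by norm_num)
  rw [Ne, e, mk_neg_eq_splitDiscriminantClass_iff_of_odd (n := 3) (by decide)]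
  have h := mul_not_mem_normUnitsSubgroup (mem_normUnitsSubgroup_of_sq_add_mul_sq (d := 1) (a := ((2 : ℚ) / 64009)) (by norm_num) ((1 : ℚ) / 253) ((1 : ℚ) / 253) (by norm_num))
    SqrtNeg1.not_mem_253
  rw [mk0_mul_mk0] at h
  norm_num at h
  exact h

/-- The same datum, CELL IDENTIFICATION: `[det H|_B] = [-253]` in `ℚˣ/Nm(ℚ(√-1)ˣ)` — the census ROW KEY of `W6.1.253` (`a·253 = (2 : ℚ) = ((1 : ℚ))² + 1·((1 : ℚ))²`).
research route conditional on HC_CM; not a corollary; Q11.4-sentence-2 already refuted in dim ≥ 3. [cite: vanGeemen1994HodgeAV, Lemma 5.2 (3)] -/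
theorem pillow4_C4S253_n253_e00d92_mk_detH_eq_key :
    (QuotientGroup.mk (Units.mk0 (-(((2 : ℚ) / 253))) (neg_ne_zero.2 (by norm_num))) : weilNormResidueGroup 1) =
      QuotientGroup.mk (Units.mk0 (-(253 : ℚ)) (neg_ne_zero.2 (by norm_num))) :=
  mk_neg_eq_mk_neg_of_mul_mem (by norm_num) (by norm_num)
    (mem_normUnitsSubgroup_of_sq_add_mul_sq _ (1 : ℚ) (1 : ℚ) (by norm_num))

/-! ### §2 `W6.2.23 = (3, ℚ(√-2), [23])`: the first curve-carried members (`GL₂(3) × S₂₃ / A₂₃`, kit j206799 / j206800) -/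

/-- FIBRE-PRODUCT datum `GL23xS23` `(0; 3:3^7.2,2:2^11.1,8a:8.4^3.3)` (cycle types in `S23`; Hurwitz dimension 0; realised by explicit permutations with product one, generation: 2-transitive + Jordan (a 2-cycle as the 3-th power of a branch cycle, 2 <= n-3) => monodromy >= A_23): `Y = D ×_{ℙ¹} X` (genus 19; `D` the `GL23`-quotient datum = the CM elliptic curve, `X` the degree-23 cover, genus 0), computed on its 552 sheets (engine `bigwin.py`, exact); the HIDDEN FACTOR `B` = the `λ`-part of the Prym `P(Y/D)` — an abelian SIXFOLD with `(3,3)` `ℚ(√-2)`-action, WEIL TYPE — has literal `det H|_B = -1/5589`, `a = 1/5589`, `T(a) = [2, 23]`: row `W6.2.23` (NON-split); `r₁ = dim_K H¹(D)_λ = 1`, `r_H = 7`. THEOREM S8 (Prym form of the product-window law, census b04.15 (A): `[a_B] = [n]^{r₁}`, no 2-transitivity needed) predicts `T(a_B) = [2, 23]` from `r₁ = 1`, `n = 23` — CONFIRMED.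
research route conditional on HC_CM; not a corollary; Q11.4-sentence-2 already refuted in dim ≥ 3. [cite: vanGeemen1994HodgeAV, (5.4.1)] -/
theorem fibre2_GL23S23_n23_fe2d24_mk_detH_ne_split :
    (QuotientGroup.mk (Units.mk0 (((-1 : ℚ) / 5589)) (by norm_num)) : weilNormResidueGroup 2) ≠
      splitDiscriminantClass 3 2 := by
  have e : Units.mk0 (((-1 : ℚ) / 5589)) (by norm_num) = -(Units.mk0 ((1 : ℚ) / 5589) (by norm_num)) := Units.ext (by norm_num)
  rw [Ne, e, mk_neg_eq_splitDiscriminantClass_iff_of_odd (n := 3) (by decide)]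
  have h := mul_not_mem_normUnitsSubgroup (mem_normUnitsSubgroup_of_sq_add_mul_sq (d := 2) (a := ((1 : ℚ) / 128547)) (by norm_num) ((1 : ℚ) / 621) ((1 : ℚ) / 621) (by norm_num))
    Summit.HodgeConjecture.HodgeConjecture.Ring2.WeilCoverage.SqrtNeg2.not_mem_23
  rw [mk0_mul_mk0] at h
  norm_num at h
  exact h

/-- The same datum, CELL IDENTIFICATION: `[det H|_B] = [-23]` in `ℚˣ/Nm(ℚ(√-2)ˣ)` — the census ROW KEY of `W6.2.23` (`a·23 = ((1 : ℚ) / 243) = (((1 : ℚ) / 27))² + 2·(((1 : ℚ) / 27))²`).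
research route conditional on HC_CM; not a corollary; Q11.4-sentence-2 already refuted in dim ≥ 3. [cite: vanGeemen1994HodgeAV, Lemma 5.2 (3)] -/
theorem fibre2_GL23S23_n23_fe2d24_mk_detH_eq_key :
    (QuotientGroup.mk (Units.mk0 (-(((1 : ℚ) / 5589))) (neg_ne_zero.2 (by norm_num))) : weilNormResidueGroup 2) =
      QuotientGroup.mk (Units.mk0 (-(23 : ℚ)) (neg_ne_zero.2 (by norm_num))) :=
  mk_neg_eq_mk_neg_of_mul_mem (by norm_num) (by norm_num)
    (mem_normUnitsSubgroup_of_sq_add_mul_sq _ ((1 : ℚ) / 27) ((1 : ℚ) / 27) (by norm_num))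

/-- FIBRE-PRODUCT datum `GL23xA23` `(0; 3:3^7.1^2,2:4.2^9.1,8a:8^2.4.2.1)` (cycle types in `A23`; Hurwitz dimension 0; realised by explicit permutations with product one, generation: randomized Schreier-Sims lower bound = 23!/2): `Y = D ×_{ℙ¹} X` (genus 24; `D` the `GL23`-quotient datum = the CM elliptic curve, `X` the degree-23 cover, genus 0), computed on its 552 sheets (engine `bigwin.py`, exact); the HIDDEN FACTOR `B` = the `λ`-part of the Prym `P(Y/D)` — an abelian SIXFOLD with `(3,3)` `ℚ(√-2)`-action, WEIL TYPE — has literal `det H|_B = -2/1863`, `a = 2/1863`, `T(a) = [2, 23]`: row `W6.2.23` (NON-split); `r₁ = dim_K H¹(D)_λ = 1`, `r_H = 7`. THEOREM S8 (Prym form of the product-window law, census b04.15 (A): `[a_B] = [n]^{r₁}`, no 2-transitivity needed) predicts `T(a_B) = [2, 23]` from `r₁ = 1`, `n = 23` — CONFIRMED.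
research route conditional on HC_CM; not a corollary; Q11.4-sentence-2 already refuted in dim ≥ 3. [cite: vanGeemen1994HodgeAV, (5.4.1)] -/
theorem fibre2_GL23A23_n23_d8ef77_mk_detH_ne_split :
    (QuotientGroup.mk (Units.mk0 (((-2 : ℚ) / 1863)) (by norm_num)) : weilNormResidueGroup 2) ≠
      splitDiscriminantClass 3 2 := by
  have e : Units.mk0 (((-2 : ℚ) / 1863)) (by norm_num) = -(Units.mk0 ((2 : ℚ) / 1863) (by norm_num)) := Units.ext (by norm_num)
  rw [Ne, e, mk_neg_eq_splitDiscriminantClass_iff_of_odd (n := 3) (by decide)]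
  have h := mul_not_mem_normUnitsSubgroup (mem_normUnitsSubgroup_of_sq_add_mul_sq (d := 2) (a := ((2 : ℚ) / 42849)) (by norm_num) (0 : ℚ) ((1 : ℚ) / 207) (by norm_num))
    Summit.HodgeConjecture.HodgeConjecture.Ring2.WeilCoverage.SqrtNeg2.not_mem_23
  rw [mk0_mul_mk0] at h
  norm_num at h
  exact h

/-- The same datum, CELL IDENTIFICATION: `[det H|_B] = [-23]` in `ℚˣ/Nm(ℚ(√-2)ˣ)` — the census ROW KEY of `W6.2.23` (`a·23 = ((2 : ℚ) / 81) = ((0 : ℚ))² + 2·(((1 : ℚ) / 9))²`).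
research route conditional on HC_CM; not a corollary; Q11.4-sentence-2 already refuted in dim ≥ 3. [cite: vanGeemen1994HodgeAV, Lemma 5.2 (3)] -/
theorem fibre2_GL23A23_n23_d8ef77_mk_detH_eq_key :
    (QuotientGroup.mk (Units.mk0 (-(((2 : ℚ) / 1863))) (neg_ne_zero.2 (by norm_num))) : weilNormResidueGroup 2) =
      QuotientGroup.mk (Units.mk0 (-(23 : ℚ)) (neg_ne_zero.2 (by norm_num))) :=
  mk_neg_eq_mk_neg_of_mul_mem (by norm_num) (by norm_num)
    (mem_normUnitsSubgroup_of_sq_add_mul_sq _ (0 : ℚ) ((1 : ℚ) / 9) (by norm_num))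

end Summit.HodgeConjecture.HodgeConjecture.Ring2.WeilCoverage
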